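/-
Copyright (c) 2026 the pub-hodgecm-mathlib formalisation cell (harness21).  Prover seat hodgecm-mathlib-K2E5-p17 (g3) (free E5 hand on the E3 road),
Track B «K2-LIT» ∕ h413 (`stmt-HodgeConjecture-24833`), line `K2_E3_EllipticInputs`, unit U12-d, §L road «U-iso-T», brick (G⁺-b) LINE SIDE, part 2:
the regularised `‖·‖⁻¹`-weighted ball values of the unramified sign character and the Fourier side on ball indicators.  2026-09-04.
-/
import Literature.NumberTheory.Automorphic.TateSelfDualHaar      -- ★ Tate: `fourierSB_indicator_vadd_primePowBall`, cosets `a +ᵥ 𝔭^N`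
import Literature.NumberTheory.Automorphic.TateGaussSums         -- ★ `TateDirect.normAbs_eq_of_sub_mem`
import Summits.HodgeConjecture.HodgeConjecture.Theorems.K2E3LocalFieldSignCharLineLemmas   -- ★ part 1 (p857375): I(n), (J), shell `‖·‖⁻¹`
import HarnessLib

/-!
# K2_E3 road (h413), §L — (G⁺-b) line side, part 2: regularised ball values `Z₀(1_B)` and the Fourier side `∫ X · (1_B)^`

Cell `pub/hodgecm-mathlib` (D-0151), Track B, seat K2E5-p17 (g3) ((G⁺-b) cut with K2E5-p10 (g4), §L lead K2E3-p12 (g4)).  `--supports stmt-HodgeConjecture-24833 --as helper`;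
THEOREMS ONLY (no definition ∕ instance ∕ notation ∕ named fact ∕ `sorry`).  COUNT-NEUTRAL.

Frame as in part 1: a non-archimedean local field `F`, additive Haar `μ`, a weight `X : F → ℂ` with `X = (−1)^j` on the shell `j` and `X 0 = 0`, an additive
character `ψ` of conductor exponent `m`.  With `n(s) := ‖s‖⁻¹` (as a complex number) and the REGULARISED functional
`Z₀(G) := ∫ X(s) n(s) (G(s) − 1_𝒪(s) G(0)) dμ(s)` (written out in full everywhere — no definitions in a Theorems file) we prove:
* §1 `n` is measurable, `‖n(s)‖ ≤ q^b` off `𝔭^b`, `X·n` is integrable on `𝔭^a ∖ 𝔭^b`;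
* §2 the ALTERNATING SHELL SUM `∫_{𝔭^a ∖ 𝔭^{a+i}} X n = (1 − q⁻¹) μ(𝒪) ((−1)^a − (−1)^{a+i})∕2` and hence `Z₀(1_{𝔭^N}) = −(1 − q⁻¹) μ(𝒪) (1 − (−1)^N)∕2`;
* §3 `Z₀(1_{a+𝔭^N}) = (−1)^v q^v μ(𝔭^N)` for `‖a‖ = (q⁻¹)^v`, `v < N` (the coset sits in the shell `v`);
* §4 the Fourier side `∫ X·(1_{a+𝔭^N})^ = μ(𝔭^N) ∫_{𝔭^{m−N}} X ψ(a·)`, evaluated in both cases by part 1.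
Part 3 (`K2E3LocalFieldQuadraticCharLineInversion`) assembles (T1) `∫ X Ĝ = γ₀ (Z₀(G) + c₀ G(0))` and the truncation identity (T2) from these.
[Tate1950, §2.5] [BushnellHenniart2006, §23.5] [Weil1974BNT, Ch. VII §2].
HONEST LABEL: HC_CM is proved only modulo the 7 printed citations (2 remaining named inputs: hLiu418 = stmt-HodgeConjecture-24832, h413 = stmt-HodgeConjecture-24833)
until rung 0 closes; count-neutral.
-/

set_option autoImplicit false
set_option linter.dupNamespace false   -- `Summit.HodgeConjecture.HodgeConjecture.…` (D-0017 nested layout; lakefile exemption for Summits)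

noncomputable section

open MeasureTheory Measure Filter Topology Set
open scoped NNReal ENNReal Pointwise
open Literature.NumberTheory.Automorphic Literature.NumberTheory.Automorphic.LocalFieldHaar
open Literature.NumberTheory.GaloisRepresentations Literature.NumberTheory.GaloisRepresentations.IsNonarchimedeanLocalField
open Summit.HodgeConjecture.HodgeConjecture.Cruxes.H413.K2E3LocalFieldSignCharLineLemmas

namespace Summit.HodgeConjecture.HodgeConjecture.Cruxes.H413.K2E3LocalFieldSignCharZetaBalls

variable {F : Type*} [Field F] [ValuativeRel F] [TopologicalSpace F] [IsNonarchimedeanLocalField F] [MeasurableSpace F] [BorelSpace F]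
  (μ : Measure F) [μ.IsAddHaarMeasure]
  {X : F → ℂ} (hXm : Measurable X) (hXb : ∀ x, ‖X x‖ ≤ 1)
  (hX : ∀ (j : ℤ) (x : F), x ∈ primePowBall F j \ primePowBall F (j + 1) → X x = (-1) ^ j) (hX0 : X 0 = 0)
  {ϖ : F} (hϖ : normAbs F ϖ = (residueFieldCard F : ℝ≥0)⁻¹)

/-! ## §1  The weight `n(s) = ‖s‖⁻¹` -/

omit [μ.IsAddHaarMeasure] in
/-- `s ↦ ‖s‖⁻¹` (as a complex number) is measurable. [folklore] -/
theorem measurable_normInv : Measurable fun s : F => ((((normAbs F s)⁻¹ : ℝ≥0) : ℝ) : ℂ) := by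
  have h : (fun s : F => ((((normAbs F s)⁻¹ : ℝ≥0) : ℝ) : ℂ)) = fun s => ((((normAbs F s : ℝ≥0) : ℝ)⁻¹ : ℝ) : ℂ) := by
    funext s; rw [NNReal.coe_inv]
  rw [h]
  exact Complex.measurable_ofReal.comp ((measurable_coe_nnreal_real.comp measurable_normAbs).inv)

omit [MeasurableSpace F] [BorelSpace F] in
/-- Off `𝔭^b` the weight is bounded: `‖‖s‖⁻¹‖ ≤ q^b` for `s ∉ 𝔭^b`. [folklore] -/
theorem norm_normInv_le {b : ℤ} {s : F} (hs : s ∉ primePowBall F b) :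
    ‖((((normAbs F s)⁻¹ : ℝ≥0) : ℝ) : ℂ)‖ ≤ (residueFieldCard F : ℝ) ^ b := by
  have hlt : ((residueFieldCard F : ℝ≥0)⁻¹) ^ b < normAbs F s := not_le.1 hs
  have h1 : (normAbs F s)⁻¹ ≤ (((residueFieldCard F : ℝ≥0)⁻¹) ^ b)⁻¹ := inv_anti₀ (zpow_pos inv_residueFieldCard_pos b) hlt.le
  rw [inv_zpow, inv_inv] at h1
  rw [Complex.norm_real, Real.norm_of_nonneg (NNReal.coe_nonneg _)]
  exact_mod_cast h1

include hXm hXb in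
/-- `X·‖·‖⁻¹` is integrable on `𝔭^a ∖ 𝔭^b`. [folklore] -/
theorem integrableOn_sign_mul_normInv (a b : ℤ) :
    IntegrableOn (fun s => X s * ((((normAbs F s)⁻¹ : ℝ≥0) : ℝ) : ℂ)) (primePowBall F a \ primePowBall F b) μ := by
  haveI : T2Space F := (isLocalField F).toT2Space
  haveI : LocallyCompactSpace F := (isLocalField F).toLocallyCompactSpace
  refine Measure.integrableOn_of_bounded (M := (residueFieldCard F : ℝ) ^ b)
    ((measure_mono Set.sdiff_subset).trans_lt (isCompact_primePowBall a).measure_lt_top).ne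
    (hXm.mul measurable_normInv).aestronglyMeasurable ?_
  rw [ae_restrict_iff' ((measurableSet_primePowBall a).diff (measurableSet_primePowBall b))]
  refine Filter.Eventually.of_forall fun s hs => ?_
  rw [norm_mul]
  calc ‖X s‖ * ‖((((normAbs F s)⁻¹ : ℝ≥0) : ℝ) : ℂ)‖ ≤ 1 * (residueFieldCard F : ℝ) ^ b :=
        mul_le_mul (hXb s) (norm_normInv_le hs.2) (norm_nonneg _) zero_le_one
    _ = (residueFieldCard F : ℝ) ^ b := one_mul _

/-! ## §2  Alternating shell sums and `Z₀(1_{𝔭^N})` -/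

omit [MeasurableSpace F] [BorelSpace F] in
/-- `𝔭^n ∖ 𝔭^{n+i+1} = (𝔭^n ∖ 𝔭^{n+i}) ∪ shell(n+i)`. [folklore] -/
theorem sdiff_primePowBall_succ_eq (n : ℤ) (i : ℕ) :
    primePowBall F n \ primePowBall F (n + (i + 1 : ℕ)) =
      (primePowBall F n \ primePowBall F (n + i)) ∪ (primePowBall F (n + i) \ primePowBall F (n + i + 1)) := by
  ext t
  simp only [Set.mem_sdiff, Set.mem_union, Nat.cast_add, Nat.cast_one, ← add_assoc]
  constructor
  · rintro ⟨h1, h2⟩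
    by_cases h3 : t ∈ primePowBall F (n + i)
    · exact Or.inr ⟨h3, h2⟩
    · exact Or.inl ⟨h1, h3⟩
  · rintro (⟨h1, h2⟩ | ⟨h1, h2⟩)
    · exact ⟨h1, fun h => h2 (primePowBall_antitone (by omega) h)⟩
    · exact ⟨primePowBall_antitone (by omega) h1, h2⟩

omit [MeasurableSpace F] [BorelSpace F] in
/-- `𝔭^n ∖ 𝔭^{n+i}` and shell `(n+i)` are disjoint. [folklore] -/
theorem disjoint_sdiff_shell (n : ℤ) (i : ℕ) :
    Disjoint (primePowBall F n \ primePowBall F (n + i)) (primePowBall F (n + i) \ primePowBall F (n + i + 1)) :=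
  Set.disjoint_left.2 fun _ ht ht' => ht.2 ht'.1

include hXm hXb hX in
/-- **Alternating shell sum**: `∫_{𝔭^a ∖ 𝔭^{a+i}} X(s) ‖s‖⁻¹ ds = (1 − q⁻¹) μ(𝒪) · ((−1)^a − (−1)^{a+i})∕2` (each shell contributes `(−1)^j (1 − q⁻¹) μ(𝒪)`).
[cite: Tate1950, §2.5] -/
theorem setIntegral_sdiff_sign_mul_normInv (a : ℤ) : ∀ i : ℕ,
    ∫ s in primePowBall F a \ primePowBall F (a + i), X s * ((((normAbs F s)⁻¹ : ℝ≥0) : ℝ) : ℂ) ∂μ =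
      (1 - (residueFieldCard F : ℂ)⁻¹) * (μ.real (primePowBall F 0) : ℂ) * (((-1) ^ a - (-1) ^ (a + i)) / 2) := by
  intro i
  induction i with
  | zero => simp
  | succ i ih =>
    rw [sdiff_primePowBall_succ_eq, setIntegral_union (disjoint_sdiff_shell a i) (measurableSet_shell _)
      ((integrableOn_sign_mul_normInv μ hXm hXb a (a + i + 1)).mono_set fun t ht => ⟨ht.1, fun h => ht.2 (primePowBall_antitone (by omega) h)⟩)
      ((integrableOn_sign_mul_normInv μ hXm hXb a (a + i + 1)).mono_set fun t ht => ⟨primePowBall_antitone (by omega) ht.1, ht.2⟩),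
      ih, setIntegral_shell_sign_mul_normInv μ hX (a + i)]
    have h1 : ((-1 : ℂ)) ^ (a + ((i + 1 : ℕ) : ℤ)) = (-1) ^ (a + i) * (-1) := by
      rw [Nat.cast_add, Nat.cast_one, ← add_assoc, zpow_add_one₀ (by norm_num : (-1 : ℂ) ≠ 0)]
    rw [h1]
    ring

open scoped Classical in
include hXm hXb hX in
/-- **`Z₀(1_{𝔭^N}) = −(1 − q⁻¹) μ(𝒪) · (1 − (−1)^N)∕2`**: the regularised functional on the ball indicators (the value is `0` for `N` even and `−(1 − q⁻¹)μ(𝒪)` for `N` odd).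
[cite: Tate1950, §2.5] -/
theorem integral_sign_mul_normInv_mul_indicator_sub (N : ℤ) :
    ∫ s, X s * ((((normAbs F s)⁻¹ : ℝ≥0) : ℝ) : ℂ) *
        ((primePowBall F N).indicator (fun _ => (1 : ℂ)) s - (primePowBall F 0).indicator (fun _ => (1 : ℂ)) s) ∂μ =
      -((1 - (residueFieldCard F : ℂ)⁻¹) * (μ.real (primePowBall F 0) : ℂ) * ((1 - (-1) ^ N) / 2)) := by
  rcases le_or_gt 0 N with hN | hN
  · -- `N ≥ 0`: the integrand is `−1_{𝒪 ∖ 𝔭^N} · X · ‖·‖⁻¹`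
    obtain ⟨k, rfl⟩ := Int.eq_ofNat_of_zero_le hN
    have h : (fun s => X s * ((((normAbs F s)⁻¹ : ℝ≥0) : ℝ) : ℂ) *
        ((primePowBall F (k : ℤ)).indicator (fun _ => (1 : ℂ)) s - (primePowBall F 0).indicator (fun _ => (1 : ℂ)) s)) =
        fun s => -((primePowBall F 0 \ primePowBall F (k : ℤ)).indicator (fun s => X s * ((((normAbs F s)⁻¹ : ℝ≥0) : ℝ) : ℂ)) s) := by
      funext s
      by_cases h0 : s ∈ primePowBall F 0
      · by_cases hk : s ∈ primePowBall F (k : ℤ)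
        · simp [h0, hk]
        · simp [h0, hk]
      · have hk : s ∉ primePowBall F (k : ℤ) := fun h => h0 (primePowBall_antitone (by omega) h)
        simp [h0, hk]
    have h2 := setIntegral_sdiff_sign_mul_normInv μ hXm hXb hX 0 k
    rw [zero_add, zpow_zero] at h2
    rw [h, integral_neg, integral_indicator ((measurableSet_primePowBall 0).diff (measurableSet_primePowBall _)), h2]
  · -- `N < 0`: the integrand is `1_{𝔭^N ∖ 𝒪} · X · ‖·‖⁻¹`
    obtain ⟨k, rfl⟩ : ∃ k : ℕ, N = -(k : ℤ) := ⟨(-N).toNat, by omega⟩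
    have h : (fun s => X s * ((((normAbs F s)⁻¹ : ℝ≥0) : ℝ) : ℂ) *
        ((primePowBall F (-(k : ℤ))).indicator (fun _ => (1 : ℂ)) s - (primePowBall F 0).indicator (fun _ => (1 : ℂ)) s)) =
        (primePowBall F (-(k : ℤ)) \ primePowBall F 0).indicator (fun s => X s * ((((normAbs F s)⁻¹ : ℝ≥0) : ℝ) : ℂ)) := by
      funext s
      by_cases hk : s ∈ primePowBall F (-(k : ℤ))
      · by_cases h0 : s ∈ primePowBall F 0
        · simp [h0, hk]
        · simp [h0, hk]
      · have h0 : s ∉ primePowBall F 0 := fun h => hk (primePowBall_antitone (by omega) h)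
        simp [h0, hk]
    have h2 := setIntegral_sdiff_sign_mul_normInv μ hXm hXb hX (-(k : ℤ)) k
    rw [neg_add_cancel, zpow_zero] at h2
    rw [h, integral_indicator ((measurableSet_primePowBall _).diff (measurableSet_primePowBall 0)), h2]
    ring

/-! ## §3  `Z₀` on a coset `a + 𝔭^N` not containing `0` -/

open scoped Classical in
include hX in
/-- **`Z₀(1_{a+𝔭^N}) = (−1)^v q^v μ(𝔭^N)`** for `‖a‖ = (q⁻¹)^v`, `v < N`: the coset lies in the shell `v`, where `X = (−1)^v` and `‖·‖⁻¹ = q^v`, and `1_{a+𝔭^N}(0) = 0`.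
[cite: Tate1950, §2.5] -/
theorem integral_sign_mul_normInv_mul_indicator_vadd {a : F} {v N : ℤ} (ha : normAbs F a = ((residueFieldCard F : ℝ≥0)⁻¹) ^ v) (hvN : v < N) :
    ∫ s, X s * ((((normAbs F s)⁻¹ : ℝ≥0) : ℝ) : ℂ) *
        ((a +ᵥ primePowBall F N).indicator (fun _ => (1 : ℂ)) s -
          (primePowBall F 0).indicator (fun _ => (a +ᵥ primePowBall F N).indicator (fun _ => (1 : ℂ)) 0) s) ∂μ =
      (-1) ^ v * (residueFieldCard F : ℂ) ^ v * (μ.real (primePowBall F N) : ℂ) := by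
  have ha' : a ∉ primePowBall F N := fun h => by have := (mem_primePowBall_iff_le ha N).1 h; omega
  have h0B : (0 : F) ∉ a +ᵥ primePowBall F N := fun h => by
    rw [mem_vadd_primePowBall_iff, zero_sub] at h
    exact ha' (by simpa using neg_mem_primePowBall h)
  have hshell : ∀ s ∈ a +ᵥ primePowBall F N, s ∈ primePowBall F v \ primePowBall F (v + 1) := fun s hs => by
    rw [mem_shell_iff, TateDirect.normAbs_eq_of_sub_mem ha' ((mem_vadd_primePowBall_iff).1 hs), ha]
  have h : (fun s => X s * ((((normAbs F s)⁻¹ : ℝ≥0) : ℝ) : ℂ) *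
        ((a +ᵥ primePowBall F N).indicator (fun _ => (1 : ℂ)) s -
          (primePowBall F 0).indicator (fun _ => (a +ᵥ primePowBall F N).indicator (fun _ => (1 : ℂ)) 0) s)) =
        (a +ᵥ primePowBall F N).indicator (fun _ => ((-1 : ℂ) ^ v * (residueFieldCard F : ℂ) ^ v)) := by
    funext s
    have h0 : (a +ᵥ primePowBall F N).indicator (fun _ => (1 : ℂ)) 0 = 0 := by simp [h0B]
    have h0' : (primePowBall F 0).indicator (fun _ => (a +ᵥ primePowBall F N).indicator (fun _ => (1 : ℂ)) 0) s = 0 := by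
      rw [h0]; exact Set.indicator_apply_eq_zero.2 fun _ => rfl
    rw [h0', sub_zero]
    by_cases hs : s ∈ a +ᵥ primePowBall F N
    · rw [Set.indicator_of_mem hs, Set.indicator_of_mem hs, hX v s (hshell s hs), normInv_eq_of_mem_shell (hshell s hs), mul_one]
    · simp [hs]
  rw [h, integral_indicator_const _ (measurableSet_vadd_primePowBall N a), Complex.real_smul,
    show μ.real (a +ᵥ primePowBall F N) = μ.real (primePowBall F N) by simp only [Measure.real, measure_vadd]]
  ring

/-! ## §4  The Fourier side on ball indicators -/

section Fourier
variable (ψ : AddChar F Circle) (hψc : Continuous ψ) {m : ℤ} (hm : ψ.HasConductorExp m)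

open scoped Classical in
include hm in
/-- `∫ X(t) (1_{a+𝔭^N})^(t) dt = μ(𝔭^N) · ∫_{𝔭^{m−N}} X(t) ψ(a t) dt` (★ Tate: `(1_{a+𝔭^N})^ = ψ(a·) μ(𝔭^N) 1_{𝔭^{m−N}}`). [cite: Tate1950, §2.5] -/
theorem integral_sign_mul_fourierSB_indicator_vadd (a : F) (N : ℤ) :
    ∫ t, X t * fourierSB ψ μ ((a +ᵥ primePowBall F N).indicator fun _ => (1 : ℂ)) t ∂μ =
      (μ.real (primePowBall F N) : ℂ) * ∫ t in primePowBall F (m - N), X t * ((ψ (a * t) : Circle) : ℂ) ∂μ := by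
  have h : (fun t => X t * fourierSB ψ μ ((a +ᵥ primePowBall F N).indicator fun _ => (1 : ℂ)) t) =
      (primePowBall F (m - N)).indicator (fun t => (μ.real (primePowBall F N) : ℂ) * (X t * ((ψ (a * t) : Circle) : ℂ))) := by
    funext t
    rw [fourierSB_indicator_vadd_primePowBall μ hm a N t, Set.indicator_apply]
    split_ifs with ht <;> ring
  rw [h, integral_indicator (measurableSet_primePowBall _), integral_const_mul]

include hXm hXb hX hX0 hϖ hψc hm in
/-- **Fourier side, coset off `0`**: for `‖a‖ = (q⁻¹)^v`, `v < N`, `∫ X (1_{a+𝔭^N})^ = μ(𝔭^N) · (−1)^{m−v} · 2∕(1+q⁻¹) · μ(𝔭^{m−v})`. [cite: Tate1950, §2.5] -/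
theorem integral_sign_mul_fourierSB_indicator_vadd_of_lt {a : F} {v N : ℤ} (ha : normAbs F a = ((residueFieldCard F : ℝ≥0)⁻¹) ^ v) (hvN : v < N) :
    ∫ t, X t * fourierSB ψ μ ((a +ᵥ primePowBall F N).indicator fun _ => (1 : ℂ)) t ∂μ =
      (μ.real (primePowBall F N) : ℂ) * ((-1) ^ (m - v) * (2 / (1 + (residueFieldCard F : ℂ)⁻¹)) * (μ.real (primePowBall F (m - v)) : ℂ)) := by
  rw [integral_sign_mul_fourierSB_indicator_vadd μ ψ hm a N,
    setIntegral_primePowBall_sign_mul_addChar μ hXm hXb hX hX0 hϖ ψ hψc hm ha (by omega)]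

include hXm hXb hX hX0 hϖ hm in
/-- **Fourier side, the ball through `0`**: for `a ∈ 𝔭^N`, `∫ X (1_{a+𝔭^N})^ = μ(𝔭^N) · (−1)^{m−N} (1 − q⁻¹)∕(1 + q⁻¹) · μ(𝔭^{m−N})` (`ψ(a·) ≡ 1` on `𝔭^{m−N}`). [cite: Tate1950, §2.5] -/
theorem integral_sign_mul_fourierSB_indicator_vadd_of_mem {a : F} {N : ℤ} (ha : a ∈ primePowBall F N) :
    ∫ t, X t * fourierSB ψ μ ((a +ᵥ primePowBall F N).indicator fun _ => (1 : ℂ)) t ∂μ =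
      (μ.real (primePowBall F N) : ℂ) * ((-1) ^ (m - N) * ((1 - (residueFieldCard F : ℂ)⁻¹) / (1 + (residueFieldCard F : ℂ)⁻¹)) *
        (μ.real (primePowBall F (m - N)) : ℂ)) := by
  rw [integral_sign_mul_fourierSB_indicator_vadd μ ψ hm a N, ← setIntegral_primePowBall_sign μ hXm hXb hX hX0 hϖ (m - N)]
  congr 1
  refine setIntegral_congr_fun (measurableSet_primePowBall _) fun t ht => ?_
  have hat : a * t ∈ primePowBall F m := by
    have := mul_mem_primePowBall ha ht
    rwa [add_sub_cancel] at this
  rw [hm.1 _ hat, Circle.coe_one, mul_one]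

end Fourier

end Summit.HodgeConjecture.HodgeConjecture.Cruxes.H413.K2E3LocalFieldSignCharZetaBalls
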